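import Mathlib
import Summits.ResolutionOfSingularities.ResolutionOfSingularities.Theorems.WeightedInvariantLocalWeightedDropNCResSurfGraphLoop
import Summits.ResolutionOfSingularities.ResolutionOfSingularities.Theorems.WeightedInvariantLocalWeightedDropNCDirectrixCutApexLineCurve

/-!
# `WeightedInvariant.LocalWeightedDrop`: LINE `directrix-cut`, piece PL₃ — `ApexPlaneExit k 3` FROM THE LOW-ESCAPE STUB ALONE
# (res-L1-w43-strat-1's glue `apexPlaneThree_of` of `pl3_split_v1` with its SURFACE input discharged by `GraphSurf.apexPlaneSurfaceThree`)

Crux item stmt-ResolutionOfSingularities-8899 `LocalWeightedDrop` (route `ResolutionOfSingularities/WeightedInvariant`), ENGINE skeleton v34/v35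
(res-L1-w43-lead-1), residual `stub_wildWideApexFourStartsWon` (W′|₄); line of record `directrix-cut` v3f (37b4c92427ddabdc), piece PL₃ `stub_apexPlaneThree`
(`ApexPlaneExit k 3`, …NCDirectrixCutHist), re-cut by res-L1-w43-strat-1's sub-skeleton `L/res-L1-w43-strat-1/g9/pl3_split_v1.lean` (7519a9009475ab47) into
`stub_apexPlaneSurfaceThree` ∧ `stub_apexPlaneLowEscapeThree` with the kernel-checked glue `apexPlaneThree_of`.  The SURFACE stub is a theorem
(`GraphSurf.apexPlaneSurfaceThree`, …NCResSurfGraphLoop, p574330); this file is strat-1's glue VERBATIM with that input supplied, so that PL₃ rests on the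
LOW-ESCAPE stub alone: **`apexPlaneExit_three_of_lowEscape : <stub_apexPlaneLowEscapeThree's text> → ∀ p prime, ∀ k …, ApexPlaneExit k 3`**.
[OURS · L1 W4.3 · chain w43 · seat res-L1-w43-stub-4 gen 6 (glue text: res-L1-w43-strat-1 gen 9); def-free; the count game is the programme's own; nothing here
is a statement of any manuscript; AI-produced, gate-checked, weaker than expert review.]
-/

set_option linter.dupNamespace false -- mandated namespace of this single-conjunct summit

namespace Summit.ResolutionOfSingularities.ResolutionOfSingularities.Theorems

namespace TameFourTupleDrop

open MvPowerSeries Literature.AlgebraicGeometry.Resolution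

/-- **PL₃ FROM THE LOW-ESCAPE STUB ALONE**: res-L1-w43-strat-1's glue `apexPlaneThree_of` (pl3_split_v1) with the surface input discharged by
`GraphSurf.apexPlaneSurfaceThree`.  The `e′ ≤ 1` exits are the tree's (`dWinsTo_headDrop_of_apexTrivial`, `TOT2E1.dWinsTo_headDrop_of_isolated`,
`apexLineCurveExit_three`); a same-head surface exit is won outright by the surface theorem; `DWinsTo.bind` + head transport, no cycle. -/
theorem apexPlaneExit_three_of_lowEscape
    (hlow : ∀ (p : ℕ), p.Prime → ∀ (k : Type) [Field k] [CharP k p] [IsAlgClosed k],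
      ∀ (b : MvPowerSeries (Fin 4) k) (δ : Decoration k 3), Admissible b δ → 2 ≤ δ.o → δ.O = ∅ → ¬ UnaryVertex δ →
        (∃ v₁ v₂ : Fin 4 → k,
          (∀ x : Fin 4 → k, CobordantChart.initEval (fun _ : Fin 4 => 1) (x + v₁) δ.c (δ.f * ∏ l ∈ δ.O, X l) =
            CobordantChart.initEval (fun _ : Fin 4 => 1) x δ.c (δ.f * ∏ l ∈ δ.O, X l)) ∧
          (∀ x : Fin 4 → k, CobordantChart.initEval (fun _ : Fin 4 => 1) (x + v₂) δ.c (δ.f * ∏ l ∈ δ.O, X l) =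
            CobordantChart.initEval (fun _ : Fin 4 => 1) x δ.c (δ.f * ∏ l ∈ δ.O, X l)) ∧
          ∀ α β : k, α • v₁ + β • v₂ = 0 → α = 0 ∧ β = 0) →
        (¬ ∃ (Φ : Fin 4 → MvPowerSeries (Fin 4) k) (a b' : Fin 4), (∀ l, constantCoeff (Φ l) = 0) ∧
          IsUnit (Matrix.det (Matrix.of fun i j : Fin 4 => coeff (Finsupp.single j 1) (Φ i))) ∧ a ≠ b' ∧
          (δ.c : ℕ∞) ≤ (subst Φ (δ.f * ∏ l ∈ δ.O, X l)).weightedOrder (fun j => if j = a ∨ j = b' then 0 else 1)) →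
        DWinsTo (St := MvPowerSeries (Fin 4) k × Decoration k 3) Prod.fst
          (fun τ => (GermIsNC τ.1 ∨ (Admissible τ.1 τ.2 ∧ τ.2.head < δ.head)) ∨
            (Admissible τ.1 τ.2 ∧ τ.2.head = δ.head ∧ ¬ UnaryVertex τ.2 ∧
              ((¬ ∃ v₁ v₂ : Fin 4 → k,
                (∀ x : Fin 4 → k, CobordantChart.initEval (fun _ : Fin 4 => 1) (x + v₁) τ.2.c (τ.2.f * ∏ l ∈ τ.2.O, X l) =
                  CobordantChart.initEval (fun _ : Fin 4 => 1) x τ.2.c (τ.2.f * ∏ l ∈ τ.2.O, X l)) ∧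
                (∀ x : Fin 4 → k, CobordantChart.initEval (fun _ : Fin 4 => 1) (x + v₂) τ.2.c (τ.2.f * ∏ l ∈ τ.2.O, X l) =
                  CobordantChart.initEval (fun _ : Fin 4 => 1) x τ.2.c (τ.2.f * ∏ l ∈ τ.2.O, X l)) ∧
                ∀ α β : k, α • v₁ + β • v₂ = 0 → α = 0 ∧ β = 0) ∨
              (∃ (Φ : Fin 4 → MvPowerSeries (Fin 4) k) (a b' : Fin 4), (∀ l, constantCoeff (Φ l) = 0) ∧
                IsUnit (Matrix.det (Matrix.of fun i j : Fin 4 => coeff (Finsupp.single j 1) (Φ i))) ∧ a ≠ b' ∧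
                (τ.2.c : ℕ∞) ≤ (subst Φ (τ.2.f * ∏ l ∈ τ.2.O, X l)).weightedOrder (fun j => if j = a ∨ j = b' then 0 else 1))))) (b, δ)) :
    ∀ (p : ℕ), p.Prime → ∀ (k : Type) [Field k] [CharP k p] [IsAlgClosed k], ApexPlaneExit k 3 := by
  intro p hp k _ _ _ b δ hadm ho hO hnU hind
  by_cases hS : ∃ (Φ : Fin 4 → MvPowerSeries (Fin 4) k) (a b' : Fin 4), (∀ l, constantCoeff (Φ l) = 0) ∧
      IsUnit (Matrix.det (Matrix.of fun i j : Fin 4 => coeff (Finsupp.single j 1) (Φ i))) ∧ a ≠ b' ∧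
      (δ.c : ℕ∞) ≤ (subst Φ (δ.f * ∏ l ∈ δ.O, X l)).weightedOrder (fun j => if j = a ∨ j = b' then 0 else 1)
  · exact GraphSurf.apexPlaneSurfaceThree p hp k b δ hadm ho hO hnU hind hS
  · refine (hlow p hp k b δ hadm ho hO hnU hind hS).bind fun τ hτ => ?_
    obtain ⟨b', δ'⟩ := τ
    rcases hτ with hT | ⟨hadm', hhead, hnU', hexit⟩
    · exact DWinsTo.of_target hT
    · have hO' : δ'.O = ∅ := Decoration.O_eq_empty_of_head_eq hhead hO
      have ho' : 2 ≤ δ'.o := by rw [Decoration.o_eq_of_head_eq hhead]; exact ho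
      -- head transport: a win relative to `δ'.head` is a win relative to `δ.head`
      have htrans : DWinsTo (St := MvPowerSeries (Fin 4) k × Decoration k 3) Prod.fst
          (fun σ => GermIsNC σ.1 ∨ (Admissible σ.1 σ.2 ∧ σ.2.head < δ'.head)) (b', δ') →
          DWinsTo (St := MvPowerSeries (Fin 4) k × Decoration k 3) Prod.fst
          (fun σ => GermIsNC σ.1 ∨ (Admissible σ.1 σ.2 ∧ σ.2.head < δ.head)) (b', δ') :=
        fun h => h.mono fun σ hσ => hσ.imp id fun h₂ => ⟨h₂.1, lt_of_lt_of_eq h₂.2 hhead⟩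
      by_cases htwo : ∃ v₁ v₂ : Fin 4 → k,
          (∀ x : Fin 4 → k, CobordantChart.initEval (fun _ : Fin 4 => 1) (x + v₁) δ'.c (δ'.f * ∏ l ∈ δ'.O, X l) =
            CobordantChart.initEval (fun _ : Fin 4 => 1) x δ'.c (δ'.f * ∏ l ∈ δ'.O, X l)) ∧
          (∀ x : Fin 4 → k, CobordantChart.initEval (fun _ : Fin 4 => 1) (x + v₂) δ'.c (δ'.f * ∏ l ∈ δ'.O, X l) =
            CobordantChart.initEval (fun _ : Fin 4 => 1) x δ'.c (δ'.f * ∏ l ∈ δ'.O, X l)) ∧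
          ∀ α β : k, α • v₁ + β • v₂ = 0 → α = 0 ∧ β = 0
      · -- the exit is a SURFACE position at the same head: the surface stub wins outright
        have hS' := hexit.resolve_left (not_not.mpr htwo)
        exact htrans (GraphSurf.apexPlaneSurfaceThree p hp k b' δ' hadm' ho' hO' hnU' htwo hS')
      · -- `e′ ≤ 1`: the dispatch of `freeLow_of_apexCut`
        by_cases h0 : ∀ u : Fin 4 → k, (∀ x : Fin 4 → k, CobordantChart.initEval (fun _ : Fin 4 => 1) (x + u) δ'.c (δ'.f * ∏ l ∈ δ'.O, X l) =
            CobordantChart.initEval (fun _ : Fin 4 => 1) x δ'.c (δ'.f * ∏ l ∈ δ'.O, X l)) → u = 0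
        · exact (dWinsTo_headDrop_of_apexTrivial hadm' h0).mono fun σ hσ => Or.inr ⟨hσ.1, lt_of_lt_of_eq hσ.2 hhead⟩
        · push Not at h0
          obtain ⟨u, hu, hu0⟩ := h0
          have hcol : ∀ v₁ v₂ : Fin 4 → k,
              (∀ x : Fin 4 → k, CobordantChart.initEval (fun _ : Fin 4 => 1) (x + v₁) δ'.c (δ'.f * ∏ l ∈ δ'.O, X l) =
                CobordantChart.initEval (fun _ : Fin 4 => 1) x δ'.c (δ'.f * ∏ l ∈ δ'.O, X l)) →
              (∀ x : Fin 4 → k, CobordantChart.initEval (fun _ : Fin 4 => 1) (x + v₂) δ'.c (δ'.f * ∏ l ∈ δ'.O, X l) =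
                CobordantChart.initEval (fun _ : Fin 4 => 1) x δ'.c (δ'.f * ∏ l ∈ δ'.O, X l)) →
              ∃ α β : k, (α ≠ 0 ∨ β ≠ 0) ∧ α • v₁ + β • v₂ = 0 := by
            intro v₁ v₂ h₁ h₂
            by_contra hne
            push Not at hne
            exact htwo ⟨v₁, v₂, h₁, h₂, fun α β hαβ => by
              by_contra hαβ0
              exact hne α β (not_and_or.mp hαβ0) hαβ⟩
          by_cases hisol : ∀ Φ : Fin 4 → MvPowerSeries (Fin 4) k, (∀ l, constantCoeff (Φ l) = 0) →
              IsUnit (Matrix.det (Matrix.of fun a j : Fin 4 => coeff (Finsupp.single j 1) (Φ a))) →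
              ¬ AxisPolyhedron.InAxisIdeal δ'.c (subst Φ (δ'.f * ∏ l ∈ δ'.O, X l))
          · exact (TOT2E1.dWinsTo_headDrop_of_isolated hadm' ho' ⟨u, hu0, hu⟩ hcol hisol).mono
              fun σ hσ => Or.inr ⟨hσ.1, lt_of_lt_of_eq hσ.2 hhead⟩
          · push Not at hisol
            obtain ⟨Φ, hΦ0, hΦdet, hax⟩ := hisol
            exact htrans (apexLineCurveExit_three p hp k b' δ' hadm' ho' hO' ⟨u, hu0, hu⟩ hcol ⟨Φ, hΦ0, hΦdet, hax⟩)

end TameFourTupleDrop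

end Summit.ResolutionOfSingularities.ResolutionOfSingularities.Theorems
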